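import Literature.Probability.RandomPlanarGeometry.LoewnerImageLifetime
import HarnessLib

/-!
# The conformal image of a Loewner chain is generated by the image curve `E_A ∘ γ ∘ τ`

Sequel of `LoewnerImageLifetime` ([LSW] 2003 §5; G. F. Lawler (2005) §4.6.1, Prop. 4.41): for a
continuous driving function `W` with `W 0 = 0` whose chain is generated by a curve `γ`
(`Loewner.IsGeneratedByCurve`), a nonempty `*`-hull `A` and an alive horizon `β`
(`Disjoint (closedHull W β) A`), the hulls of the image chain — the Loewner chain of the image
driving function `imageDriverC W A β = W̃ ∘ τ` in capacity time (`LoewnerImageChain`), whose hulls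
are `E_A(K_{τ q})` (`hull_imageDriverC_eq`) — are the sets filled in by the **image curve**
`γ̂ = E_A ∘ γ ∘ τ` (`E_A = hullExt (starRMap A hA)` the Schwarz reflection of `Φ_A`,
`τ = imageClockInv W A β` the inverse capacity clock):

* `hull_imageDriverC_eq_compl_unboundedComponent` — **`K̃_q = ℍ ∖ (unbounded component of
  ℍ ∖ γ̂[0, q])`** for `q < σ β`, i.e. the defining clause of `IsGeneratedByCurve` for the image
  chain on `[0, σ β)`;
* `continuousOn_imageCurve`, `imageCurve_zero`, `imageCurve_im_nonneg`, `imageDriverC_zero` — the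
  image curve is continuous on `[0, σ β]`, starts at `0 = (W̃ ∘ τ) 0` and lies in `ℍ̄`.

Proof of the hull identity (pure planar topology, at the time `t = τ q`): the past `γ[0, t]` lies
in the closed hull `K̂_t`, hence misses `A`; its real points are mapped by `E_A` to real points and
its points in `ℍ` by `Φ_A`, so `ℍ ∖ γ̂[0, q] = Φ_A((ℍ ∖ A) ∖ γ[0, t])`. The set `H_t ∖ A` is
connected (`isPreconnected_domain_diff`, Janiszewski) and unbounded, so its image under `Φ_A`
(continuous, `∼ z` at `∞`) is a connected unbounded subset of `ℍ ∖ γ̂[0, q]`, hence lies in the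
unbounded component; conversely the unbounded component is connected and unbounded, so its image
under `Φ_A⁻¹` (continuous, `∼ ζ` at `∞`) lies in the unbounded component `H_t` of `ℍ ∖ γ[0, t]`
(`IsGeneratedByCurve.domain_eq`). Hence the unbounded component of `ℍ ∖ γ̂[0, q]` is exactly
`Φ_A(H_t ∖ A)`, and its complement in `ℍ = Φ_A(ℍ ∖ A)` is `Φ_A(K_t) = E_A(K_t)`. No named fact, no
definition.

## References

* G. F. Lawler, O. Schramm, W. Werner, *Conformal restriction: the chordal case* (2003), §5
  (`K̃_t = Φ_A(K_t)`, the chain `g̃_t`). [LawlerSchrammWerner2003Restriction]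
* G. F. Lawler, *Conformally Invariant Processes in the Plane* (2005), §4.6.1 Prop. 4.41; §4.1
  (chains generated by a curve). [Lawler2005]
-/

noncomputable section

open Set Filter Metric Bornology Function
open _root_.Complex _root_.Topology
open UpperHalfPlane (upperHalfPlaneSet)
open scoped NNReal ComplexConjugate

namespace Literature.Probability.RandomPlanarGeometry

/-! ### Unbounded sets stay unbounded under maps which are `∼ z` at `∞` -/

/-- If `‖z‖ ≤ ‖f z‖ + c` for the points of `T` outside a disc and `T` is unbounded, then `f(T)` is
unbounded. [folklore] -/
theorem not_isBounded_image_of_norm_le {f : ℂ → ℂ} {T : Set ℂ} {R c : ℝ}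
    (hf : ∀ z ∈ T, R < ‖z‖ → ‖z‖ ≤ ‖f z‖ + c) (hT : ¬ IsBounded T) : ¬ IsBounded (f '' T) := by
  intro hb
  obtain ⟨M, hM⟩ := hb.subset_closedBall 0
  refine hT ((isBounded_closedBall (x := (0 : ℂ)) (r := max R (M + c))).subset fun z hz ↦ ?_)
  rw [mem_closedBall_zero_iff]
  by_cases hzR : R < ‖z‖
  · have h1 := hf z hz hzR
    have h2 : ‖f z‖ ≤ M := mem_closedBall_zero_iff.1 (hM ⟨z, hz, rfl⟩)
    exact le_max_of_le_right (by linarith)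
  · exact le_max_of_le_left (not_lt.1 hzR)

section Infinity

variable {B : Set ℂ} {Φ : ConformalEquiv (upperHalfPlaneSet \ B) upperHalfPlaneSet}

/-- **`‖z‖ ≤ ‖E_B(z)‖ + (‖L‖ + 1)` far out** (`E_B(z) − z → L = hullShift Φ` at `∞`,
`tendsto_hullExt_sub_self`). [cite: Lawler2005, §3.4 proof of Prop. 3.36] -/
theorem exists_forall_norm_le_norm_hullExt_add (hB : IsBoundedHull B) (hΦ : IsRestrictionMap B Φ) :
    ∃ R : ℝ, ∀ z : ℂ, R < ‖z‖ → ‖z‖ ≤ ‖hullExt Φ z‖ + (‖hullShift Φ‖ + 1) := by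
  have hev := tendsto_hullExt_sub_self hB hΦ (ball_mem_nhds _ one_pos)
  rw [← cobounded_eq_cocompact] at hev
  obtain ⟨R, -, hR⟩ := (hasBasis_cobounded_compl_closedBall (0 : ℂ)).mem_iff.1 hev
  refine ⟨R, fun z hz ↦ ?_⟩
  have h1 : dist (hullExt Φ z - z) (hullShift Φ) < 1 :=
    hR (by rw [mem_compl_iff, mem_closedBall_zero_iff, not_le]; exact hz)
  rw [dist_eq_norm] at h1
  have h2 : ‖hullExt Φ z - z‖ ≤ ‖hullShift Φ‖ + 1 := by
    have := norm_sub_norm_le (hullExt Φ z - z) (hullShift Φ)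
    linarith
  have h3 : ‖z‖ ≤ ‖hullExt Φ z‖ + ‖hullExt Φ z - z‖ := by
    have := norm_sub_le (hullExt Φ z) (hullExt Φ z - z)
    rwa [sub_sub_cancel] at this
  linarith

/-- **`‖ζ‖ ≤ ‖Φ_B⁻¹(ζ)‖ + (‖L‖ + 1)` far out in `ℍ`** (`Φ_B⁻¹(ζ) − ζ → −L` at `∞`,
`IsRestrictionMap.tendsto_symm_sub_self`). [cite: LawlerSchrammWerner2003Restriction, §2 pp. 7–8 (g_A(z) − z → 0)] -/
theorem exists_forall_norm_le_norm_symm_add (hB : IsStarHull B) (hΦ : IsRestrictionMap B Φ) :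
    ∃ R : ℝ, ∀ ζ ∈ upperHalfPlaneSet, R < ‖ζ‖ → ‖ζ‖ ≤ ‖Φ.symm ζ‖ + (‖hullShift Φ‖ + 1) := by
  have hev := hΦ.tendsto_symm_sub_self hB (ball_mem_nhds _ one_pos)
  rw [← cobounded_eq_cocompact] at hev
  obtain ⟨R, -, hR⟩ := ((hasBasis_cobounded_compl_closedBall (0 : ℂ)).inf_principal _).mem_iff.1 hev
  refine ⟨R, fun ζ hζ hζR ↦ ?_⟩
  have h1 : dist (Φ.symm ζ - ζ) (-hullShift Φ) < 1 :=
    hR ⟨by rw [mem_compl_iff, mem_closedBall_zero_iff, not_le]; exact hζR, hζ⟩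
  rw [dist_eq_norm, sub_neg_eq_add] at h1
  have h2 : ‖Φ.symm ζ - ζ‖ ≤ ‖hullShift Φ‖ + 1 := by
    have := norm_sub_le (Φ.symm ζ - ζ + hullShift Φ) (hullShift Φ)
    rw [add_sub_cancel_right] at this
    linarith
  have h3 : ‖ζ‖ ≤ ‖Φ.symm ζ‖ + ‖Φ.symm ζ - ζ‖ := by
    have := norm_sub_le (Φ.symm ζ) (Φ.symm ζ - ζ)
    rwa [sub_sub_cancel] at this
  linarith

end Infinity

namespace Loewner

variable {W : ℝ≥0 → ℝ} {A : Set ℂ}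

/-! ### The past of the curve lies in the closed hull, hence misses an alive `*`-hull -/

section Past

variable {γ : ℝ≥0 → ℂ}

/-- **`γ[0, s] ⊆ K̂_s`**: the past of a generating curve lies in the closed hull (for `s > 0` it lies
in `closure K_s ⊆ K̂_s`, `IsGeneratedByCurve.image_Icc_subset_closure_hull`; `γ 0 = W 0 ∈ K̂_0`).
[cite: Lawler2005, Ch. 4 §4.1] -/
theorem IsGeneratedByCurve.image_Icc_subset_closedHull (hW : Continuous W) (hγ : IsGeneratedByCurve W γ)
    (s : ℝ≥0) : γ '' Icc 0 s ⊆ closedHull W s := by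
  rcases (show (0 : ℝ≥0) ≤ s from zero_le).eq_or_lt with hs | hs
  · rintro _ ⟨r, hr, rfl⟩
    have hr0 : r = 0 := le_antisymm (hs ▸ hr.2) zero_le
    rw [hr0, hγ.apply_zero]
    exact ⟨by simp, (swallowingTime_driving_le W).trans bot_le⟩
  · exact (hγ.image_Icc_subset_closure_hull hW hs).trans
      (closure_minimal (hull_subset_closedHull W s) (isClosed_closedHull hW s))

/-- Before an alive time the curve has not visited `A`. [folklore] -/
theorem IsGeneratedByCurve.apply_notMem_of_alive (hW : Continuous W) (hγ : IsGeneratedByCurve W γ)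
    {s : ℝ≥0} (hs : Disjoint (closedHull W s) A) {r : ℝ≥0} (hr : r ≤ s) : γ r ∉ A :=
  fun h ↦ Set.disjoint_left.1 hs (hγ.image_Icc_subset_closedHull hW s ⟨r, ⟨zero_le, hr⟩, rfl⟩) h

/-- Before an alive time the curve stays in the symmetric domain `ℂ ∖ (A ∪ Ā)` of `A ⊆ ℍ̄` (where
`E_A` is holomorphic). [folklore] -/
theorem IsGeneratedByCurve.apply_mem_symmDomain (hW : Continuous W) (hγ : IsGeneratedByCurve W γ)
    (hA : IsBoundedHull A) {s : ℝ≥0} (hs : Disjoint (closedHull W s) A) {r : ℝ≥0} (hr : r ≤ s) :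
    γ r ∈ symmDomain A := by
  have h1 := hγ.apply_notMem_of_alive hW hs hr
  refine ⟨h1, fun h2 ↦ h1 ?_⟩
  have h3 : 0 ≤ (conj (γ r)).im := by
    have := hA.subset_closure h2
    rwa [show upperHalfPlaneSet = {z : ℂ | 0 < z.im} from rfl, closure_setOf_lt_im] at this
  rw [conj_im] at h3
  have h4 : (γ r).im = 0 := le_antisymm (by linarith) (hγ.im_nonneg r)
  rwa [conj_eq_iff_im.2 h4] at h2

end Past

/-! ### The unbounded component of `ℍ ∖ E_A(γ[0, t])` is `Φ_A(H_t ∖ A)` -/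

section Component

variable {γ : ℝ≥0 → ℂ} (hW : Continuous W) (hA : IsStarHull A) {t : ℝ≥0}
  (ht : Disjoint (closedHull W t) A) (hγ : IsGeneratedByCurve W γ)
include hW ht hγ

/-- **The unbounded component of `ℍ ∖ E_A(γ[0, t])` is `Φ_A(H_t ∖ A)`** for an alive time `t`:
`Φ_A(H_t ∖ A)` is connected (`isPreconnected_domain_diff`), unbounded and disjoint from
`E_A(γ[0, t])`, so it lies in the unbounded component; the latter is connected and unbounded, so
its preimage under `Φ_A` lies in the unbounded component `H_t` of `ℍ ∖ γ[0, t]`.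
[cite: LawlerSchrammWerner2003Restriction, §5 (K̃_t = Φ_A(K_t))] -/
theorem unboundedComponent_diff_image_hullExt_eq :
    unboundedComponent (upperHalfPlaneSet \ hullExt (starRMap A hA) '' (γ '' Icc 0 t)) =
      starRMap A hA '' (domain W t \ A) := by
  set Φ := starRMap A hA with hΦdef
  have hΦ : IsRestrictionMap A Φ := isRestrictionMap_starRMap hA
  have hAb := hA.isBoundedHull
  set C : Set ℂ := γ '' Icc 0 t with hC
  -- the past misses `A`, lies in `ℍ̄` and in the symmetric domain
  have hCA : Disjoint C A := Set.disjoint_left.2 fun c hc hcA ↦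
    Set.disjoint_left.1 ht (hγ.image_Icc_subset_closedHull hW t hc) hcA
  have hCim : ∀ c ∈ C, 0 ≤ c.im := by
    rintro _ ⟨r, -, rfl⟩; exact hγ.im_nonneg r
  have hCΩ : ∀ c ∈ C, c ∈ symmDomain A := by
    rintro _ ⟨r, hr, rfl⟩; exact hγ.apply_mem_symmDomain hW hAb ht hr.2
  -- real points of the past have real images
  have hEreal : ∀ c ∈ C, c.im = 0 → (hullExt Φ c).im = 0 := fun c hc h0 ↦ by
    have hc' : ((c.re : ℝ) : ℂ) = c := Complex.ext (by simp) (by simp [h0])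
    have hcA : ((c.re : ℝ) : ℂ) ∉ A := by rw [hc']; exact Set.disjoint_left.1 hCA hc
    have := hullExt_ofReal_im hAb hΦ hcA
    rwa [hc'] at this
  -- (1) `Φ(H_t ∖ A)` lies in the unbounded component
  have hsub1 : Φ '' (domain W t \ A) ⊆ upperHalfPlaneSet \ hullExt Φ '' C := by
    rintro _ ⟨u, ⟨huU, huA⟩, rfl⟩
    have huH : u ∈ upperHalfPlaneSet := domain_subset W t huU
    have hpos : 0 < (Φ u).im := Φ.mapsTo ⟨huH, huA⟩
    refine ⟨hpos, ?_⟩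
    rintro ⟨c, hc, hcu⟩
    rcases (hCim c hc).eq_or_lt with h0 | hcpos
    · have h1 := hEreal c hc h0.symm
      rw [hcu] at h1
      exact absurd h1 hpos.ne'
    · rw [hullExt_of_im_pos hcpos] at hcu
      obtain rfl : c = u := Φ.injOn ⟨hcpos, Set.disjoint_left.1 hCA hc⟩ ⟨huH, huA⟩ hcu
      exact huU.2 (hγ.mem_hull_of_mem_image hcpos hc)
  obtain ⟨R₁, hR₁⟩ := exists_forall_norm_le_norm_hullExt_add hAb hΦ
  have hunb1 : ¬ IsBounded (Φ '' (domain W t \ A)) := by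
    refine not_isBounded_image_of_norm_le (R := R₁) (c := ‖hullShift Φ‖ + 1) (fun u hu huR ↦ ?_) ?_
    · rw [← hullExt_of_mem_diff ⟨domain_subset W t hu.1, hu.2⟩]; exact hR₁ u huR
    · exact fun hb ↦ hγ.not_isBounded_domain t ((hb.union hAb.1).subset (subset_sdiff_union _ _))
  have hpre1 : IsPreconnected (Φ '' (domain W t \ A)) :=
    (isPreconnected_domain_diff hW hAb ht).image _
      (Φ.continuousOn.mono fun u hu ↦ ⟨domain_subset W t hu.1, hu.2⟩)
  have hdir1 := subset_unboundedComponent_of_isPreconnected hpre1 hsub1 hunb1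
  -- (2) the unbounded component pulls back into `H_t ∖ A`
  set Uh := unboundedComponent (upperHalfPlaneSet \ hullExt Φ '' C) with hUh
  have hUhH : Uh ⊆ upperHalfPlaneSet := fun ζ hζ ↦ hζ.1.1
  have hEcont : ContinuousOn (hullExt Φ) C := fun c hc ↦
    (differentiableAt_hullExt hAb hΦ (hCΩ c hc)).continuousAt.continuousWithinAt
  have hECb : IsBounded (hullExt Φ '' C) := ((hγ.isCompact_image t).image_of_continuousOn hEcont).isBounded
  have hunbUh : ¬ IsBounded Uh := by
    obtain ⟨R, hR⟩ := hECb.subset_closedBall 0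
    obtain ⟨h1, h2⟩ := farPoint_mem R
    rw [hUh, unboundedComponent_eq_connectedComponentIn hR h1 h2]
    exact (mem_unboundedComponent_of_lt_norm hR h1 h2).2
  have hsub2 : Φ.symm '' Uh ⊆ upperHalfPlaneSet \ C := by
    rintro _ ⟨ζ, hζ, rfl⟩
    have hz := Φ.symm_mapsTo (hUhH hζ)
    refine ⟨hz.1, fun hzC ↦ hζ.1.2 ⟨Φ.symm ζ, hzC, ?_⟩⟩
    rw [hullExt_of_mem_diff hz, Φ.apply_symm_apply (hUhH hζ)]
  obtain ⟨R₂, hR₂⟩ := exists_forall_norm_le_norm_symm_add hA hΦ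
  have hpre2 : IsPreconnected (Φ.symm '' Uh) :=
    (isConnected_unboundedComponent hECb).isPreconnected.image _ (Φ.symm.continuousOn.mono hUhH)
  have hunb2 : ¬ IsBounded (Φ.symm '' Uh) :=
    not_isBounded_image_of_norm_le (fun ζ hζ hζR ↦ hR₂ ζ (hUhH hζ) hζR) hunbUh
  have hdir2 : Φ.symm '' Uh ⊆ domain W t := by
    rw [hγ.domain_eq t]
    exact subset_unboundedComponent_of_isPreconnected hpre2 hsub2 hunb2
  refine Subset.antisymm (fun ζ hζ ↦ ?_) hdir1
  have hz := Φ.symm_mapsTo (hUhH hζ)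
  exact ⟨Φ.symm ζ, ⟨hdir2 ⟨ζ, hζ, rfl⟩, hz.2⟩, Φ.apply_symm_apply (hUhH hζ)⟩

/-- **`E_A(K_t) = ℍ ∖ (unbounded component of ℍ ∖ E_A(γ[0, t]))`** for an alive time `t`: the
complement in `ℍ = Φ_A(ℍ ∖ A)` of `Φ_A(H_t ∖ A)` is `Φ_A(K_t)` (`K_t ⊆ ℍ ∖ A`).
[cite: LawlerSchrammWerner2003Restriction, §5 (K̃_t = Φ_A(K_t))] -/
theorem image_starMap_hull_eq :
    starMap A '' hull W t = upperHalfPlaneSet \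
      unboundedComponent (upperHalfPlaneSet \ hullExt (starRMap A hA) '' (γ '' Icc 0 t)) := by
  rw [unboundedComponent_diff_image_hullExt_eq hW hA ht hγ, starMap_eq hA]
  set Φ := starRMap A hA with hΦdef
  have hKA : ∀ z ∈ hull W t, z ∈ upperHalfPlaneSet \ A := fun z hz ↦
    ⟨hz.1, fun hzA ↦ Set.disjoint_left.1 ht (hull_subset_closedHull W t hz) hzA⟩
  ext ζ
  constructor
  · rintro ⟨z, hzK, rfl⟩
    have hz := hKA z hzK
    rw [hullExt_of_mem_diff hz]
    refine ⟨Φ.mapsTo hz, ?_⟩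
    rintro ⟨u, ⟨huU, huA⟩, hu⟩
    obtain rfl : u = z := Φ.injOn ⟨domain_subset W t huU, huA⟩ hz hu
    exact huU.2 hzK
  · rintro ⟨hζH, hζU⟩
    have hz := Φ.symm_mapsTo hζH
    by_cases hzK : Φ.symm ζ ∈ hull W t
    · exact ⟨Φ.symm ζ, hzK, by rw [hullExt_of_mem_diff hz, Φ.apply_symm_apply hζH]⟩
    · exact absurd ⟨Φ.symm ζ, ⟨⟨hz.1, hzK⟩, hz.2⟩, Φ.apply_symm_apply hζH⟩ hζU

end Component

/-! ### The image curve `γ̂ = E_A ∘ γ ∘ τ` in capacity time -/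

section Curve

/-- The inverse clock maps `[0, q]` onto `[0, τ q]` (`τ` continuous and increasing with `τ 0 = 0`;
explicitly, `s = τ (σ s)`). [folklore] -/
theorem image_toNNReal_imageClockInv_Icc (hW : Continuous W) (hA : IsStarHull A) (hne : A.Nonempty)
    {β : ℝ≥0} (hβ : Disjoint (closedHull W β) A) {q : ℝ} (hq : q ∈ Icc (0 : ℝ) (imageClock W A β)) :
    (fun r : ℝ ↦ (imageClockInv W A β r).toNNReal) '' Icc (0 : ℝ) q =
      Icc (0 : ℝ≥0) (imageClockInv W A β q).toNNReal := by
  have hmonoτ := strictMonoOn_imageClockInv hW hA hne hβ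
  have hmonoσ := strictMonoOn_imageClock hW hA hne hβ
  obtain ⟨hτI, hστ⟩ := imageClockInv_spec hW hA hne hβ hq
  refine Subset.antisymm ?_ fun s hs ↦ ?_
  · rintro _ ⟨r, hr, rfl⟩
    have hrI : r ∈ Icc (0 : ℝ) (imageClock W A β) := ⟨hr.1, hr.2.trans hq.2⟩
    exact ⟨zero_le, Real.toNNReal_le_toNNReal (hmonoτ.monotoneOn hrI hq hr.2)⟩
  · have hs' : (s : ℝ) ≤ imageClockInv W A β q := by
      have := NNReal.coe_le_coe.2 hs.2
      rwa [Real.coe_toNNReal _ hτI.1] at this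
    have hsβ : (s : ℝ) ∈ Icc (0 : ℝ) β := ⟨s.coe_nonneg, hs'.trans hτI.2⟩
    refine ⟨imageClock W A s, ⟨(imageClock_mem hW hA hne hβ hsβ).1, ?_⟩, ?_⟩
    · have := hmonoσ.monotoneOn hsβ hτI hs'
      rwa [hστ] at this
    · show (imageClockInv W A β (imageClock W A s)).toNNReal = s
      rw [imageClockInv_imageClock hW hA hne hβ hsβ, Real.toNNReal_coe]

/-- **`γ̂[0, q] = E_A(γ[0, τ q])`.** [folklore] -/
theorem image_imageCurve_Icc (hW : Continuous W) (hA : IsStarHull A) (hne : A.Nonempty) {β : ℝ≥0}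
    (hβ : Disjoint (closedHull W β) A) {γ : ℝ≥0 → ℂ} {q : ℝ} (hq : q ∈ Icc (0 : ℝ) (imageClock W A β)) :
    (fun r : ℝ ↦ hullExt (starRMap A hA) (γ (imageClockInv W A β r).toNNReal)) '' Icc (0 : ℝ) q =
      hullExt (starRMap A hA) '' (γ '' Icc 0 (imageClockInv W A β q).toNNReal) := by
  rw [← image_toNNReal_imageClockInv_Icc hW hA hne hβ hq, image_image, image_image]

/-- `τ q ≤ β` (as a time in `ℝ≥0`) for `q ∈ [0, σ β]`. [folklore] -/
theorem toNNReal_imageClockInv_le (hW : Continuous W) (hA : IsStarHull A) (hne : A.Nonempty) {β : ℝ≥0}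
    (hβ : Disjoint (closedHull W β) A) {q : ℝ} (hq : q ∈ Icc (0 : ℝ) (imageClock W A β)) :
    (imageClockInv W A β q).toNNReal ≤ β := by
  obtain ⟨hτI, -⟩ := imageClockInv_spec hW hA hne hβ hq
  rw [← NNReal.coe_le_coe, Real.coe_toNNReal _ hτI.1]
  exact hτI.2

/-- **The image driving function starts at `0`**: `(W̃ ∘ τ) 0 = W̃_0 = 0` (`W 0 = 0`), so that the
image curve starts at the image driving point. [folklore] -/
theorem imageDriverC_zero (hW : Continuous W) (hW0 : W 0 = 0) (hA : IsStarHull A) (hne : A.Nonempty)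
    {β : ℝ≥0} (hβ : Disjoint (closedHull W β) A) : imageDriverC W A β 0 = 0 := by
  have hS0 : 0 ≤ imageClock W A β := (imageClock_mem hW hA hne hβ ⟨β.coe_nonneg, le_rfl⟩).1
  rw [← Real.toNNReal_zero, imageDriverC_toNNReal ⟨le_rfl, hS0⟩, imageClockInv_zero hW hA hne hβ,
    Real.toNNReal_zero, imageDriver_zero hW hW0 hA]

/-- **The hulls of the image chain are filled in by the image curve**: for `q < σ β`,
`Loewner.hull (W̃ ∘ τ) q = ℍ ∖ (unbounded component of ℍ ∖ γ̂[0, q])`, `γ̂ = E_A ∘ γ ∘ τ` — the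
defining clause of `IsGeneratedByCurve` for the image chain ([LSW] §5: the chain `(g̃_t)` has hulls
`Φ_A(K_t)`, generated by `Φ_A ∘ γ`; Lawler's Prop. 4.41).
[cite: LawlerSchrammWerner2003Restriction, §5 (K̃_t = Φ_A(K_t)); Lawler2005, Prop. 4.41] -/
theorem hull_imageDriverC_eq_compl_unboundedComponent (hW : Continuous W) (hW0 : W 0 = 0)
    (hA : IsStarHull A) (hne : A.Nonempty) {β : ℝ≥0} (hβ : Disjoint (closedHull W β) A)
    {γ : ℝ≥0 → ℂ} (hγ : IsGeneratedByCurve W γ) {q : ℝ≥0} (hq : (q : ℝ) < imageClock W A β) :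
    hull (imageDriverC W A β) q = upperHalfPlaneSet \
      unboundedComponent (upperHalfPlaneSet \
        (fun r : ℝ ↦ hullExt (starRMap A hA) (γ (imageClockInv W A β r).toNNReal)) '' Icc (0 : ℝ) q) := by
  have hqI : (q : ℝ) ∈ Icc (0 : ℝ) (imageClock W A β) := ⟨q.coe_nonneg, hq.le⟩
  rw [hull_imageDriverC_eq hW hW0 hA hne hβ hq, image_imageCurve_Icc hW hA hne hβ hqI,
    image_starMap_hull_eq hW hA (alive_mono (toNNReal_imageClockInv_le hW hA hne hβ hqI) hβ) hγ]

/-- **The image curve is continuous on `[0, σ β]`** (`τ` is continuous there, `γ` everywhere, and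
`E_A` at the points `γ(τ r) ∈ ℂ ∖ (A ∪ Ā)`). [folklore] -/
theorem continuousOn_imageCurve (hW : Continuous W) (hA : IsStarHull A) (hne : A.Nonempty) {β : ℝ≥0}
    (hβ : Disjoint (closedHull W β) A) {γ : ℝ≥0 → ℂ} (hγ : IsGeneratedByCurve W γ) :
    ContinuousOn (fun r : ℝ ↦ hullExt (starRMap A hA) (γ (imageClockInv W A β r).toNNReal))
      (Icc 0 (imageClock W A β)) := by
  intro r hr
  have hle := toNNReal_imageClockInv_le hW hA hne hβ hr
  have hE : ContinuousAt (hullExt (starRMap A hA)) (γ (imageClockInv W A β r).toNNReal) :=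
    (differentiableAt_hullExt hA.isBoundedHull (isRestrictionMap_starRMap hA)
      (hγ.apply_mem_symmDomain hW hA.isBoundedHull hβ hle)).continuousAt
  have hτc : ContinuousWithinAt (fun r : ℝ ↦ (imageClockInv W A β r).toNNReal)
      (Icc 0 (imageClock W A β)) r :=
    continuous_real_toNNReal.continuousAt.comp_continuousWithinAt
      (f := imageClockInv W A β) (x := r) (continuousOn_imageClockInv hW hA hne hβ r hr)
  have hγc : ContinuousWithinAt (fun r : ℝ ↦ γ (imageClockInv W A β r).toNNReal)
      (Icc 0 (imageClock W A β)) r :=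
    hγ.continuous.continuousAt.comp_continuousWithinAt
      (f := fun r : ℝ ↦ (imageClockInv W A β r).toNNReal) (x := r) hτc
  exact hE.comp_continuousWithinAt (f := fun r : ℝ ↦ γ (imageClockInv W A β r).toNNReal) (x := r) hγc

/-- **The image curve lies in `ℍ̄`** on `[0, σ β]`: points of `γ` in `ℍ ∖ A` go to `ℍ`, real points
off `A` to `ℝ`. [folklore] -/
theorem imageCurve_im_nonneg (hW : Continuous W) (hA : IsStarHull A) (hne : A.Nonempty) {β : ℝ≥0}
    (hβ : Disjoint (closedHull W β) A) {γ : ℝ≥0 → ℂ} (hγ : IsGeneratedByCurve W γ) {r : ℝ}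
    (hr : r ∈ Icc (0 : ℝ) (imageClock W A β)) :
    0 ≤ (hullExt (starRMap A hA) (γ (imageClockInv W A β r).toNNReal)).im := by
  have hle := toNNReal_imageClockInv_le hW hA hne hβ hr
  set c := γ (imageClockInv W A β r).toNNReal with hc
  have hcA : c ∉ A := hγ.apply_notMem_of_alive hW hβ hle
  rcases (hγ.im_nonneg (imageClockInv W A β r).toNNReal).eq_or_lt with h0 | hpos
  · have hc' : ((c.re : ℝ) : ℂ) = c := Complex.ext (by simp) (by simp [hc, ← h0])
    have hcA' : ((c.re : ℝ) : ℂ) ∉ A := by rw [hc']; exact hcA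
    have := hullExt_ofReal_im hA.isBoundedHull (isRestrictionMap_starRMap hA) hcA'
    rw [hc'] at this
    exact this.ge
  · exact (hullExt_im_pos (Φ := starRMap A hA) ⟨hpos, hcA⟩).le

/-- **The image curve starts at `0`**: `γ̂ 0 = E_A(γ 0) = E_A(W 0) = E_A(0) = 0` (`W 0 = 0`).
[folklore] -/
theorem imageCurve_zero (hW : Continuous W) (hW0 : W 0 = 0) (hA : IsStarHull A) (hne : A.Nonempty)
    {β : ℝ≥0} (hβ : Disjoint (closedHull W β) A) {γ : ℝ≥0 → ℂ} (hγ : IsGeneratedByCurve W γ) :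
    hullExt (starRMap A hA) (γ (imageClockInv W A β 0).toNNReal) = 0 := by
  rw [imageClockInv_zero hW hA hne hβ, Real.toNNReal_zero, hγ.apply_zero, hW0, ofReal_zero,
    hullExt_zero hA (isRestrictionMap_starRMap hA)]

end Curve

end Loewner

end Literature.Probability.RandomPlanarGeometry

end
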